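import Mathlib.MeasureTheory.Constructions.BorelSpace.Metrizable
import Mathlib.MeasureTheory.Function.Floor
import Mathlib.MeasureTheory.Integral.Prod
import Mathlib.MeasureTheory.Integral.IntervalIntegral.Basic
import Literature.Analysis.FluidPDE.HardSphereDynamicsProofs
import HarnessLib

/-!
# Joint measurability of the hard-sphere flow on its good set, and measurability of time averages

A hard-sphere flow `Φ : Literature.Analysis.FluidPDE.HardSphereFlow G ε N` (Alexander's theorem
as a hypothesis structure, `HardSphereDynamics`) only records that each time-`t` map `Φ_t` is
measurable. On the good set the orbits are hard-sphere trajectories, hence right-continuous in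
time (`IsHardSphereTrajectory.tendsto_nhdsGT`), and a map which is measurable in `z` for each `s`
and right-continuous in `s` for each `z` is jointly measurable (approximate `s` from the right by
the dyadic grid). This file proves that, and deduces the measurability of the time integrals
`z ↦ ∫_a^b f(Φ_s z) ds` that enter window-averaged observables (e.g. the exponential moments of
time-averaged currents in hydrodynamic-limit statements) — implicit whenever such quantities are
integrated against a law on phase space (Cercignani–Illner–Pulvirenti 1994 §4.2, App. 4.A;
Gallagher–Saint-Raymond–Texier 2013 §4.2).

* `HardSphereFlow.measurable_flow_prod` — `(z, s) ↦ Φ_s z` is measurable on `Φ.good × ℝ`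
  (Hausdorff/metrizable second-countable Borel position space, continuous translations: true for
  `ℝ^d` and `T^d`; `measurable_flow_prod_torus`).
* `HardSphereFlow.stronglyMeasurable_integral_comp_flow` — for a strongly measurable observable
  `f` and an s-finite measure `ν` on `ℝ`, `z ↦ ∫ f(Φ_s z) dν(s)` is strongly measurable on the
  good set; `HardSphereFlow.aemeasurable_intervalIntegral_comp_flow` — for real-valued measurable
  `f`, `z ↦ ∫_a^b f(Φ_s z) ds` is a.e.-measurable for every measure carried by the good set
  (e.g. the Liouville measure and every law absolutely continuous with respect to it).
* `HardSphereFlow.aemeasurable_of_measurable_comp_subtype` — the glue: a function measurable on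
  the (measurable, conull) good set is a.e.-measurable.

## Mathlib / Literature reuse

`measurable_of_tendsto_metrizable`, `measurable_from_prod_countable_left`, `Int.measurable_floor`,
`MeasureTheory.StronglyMeasurable.integral_prod_right'`, `Measurable.dite` are Mathlib's; the
right-continuity of trajectories is `IsHardSphereTrajectory.tendsto_nhdsGT`
(`HardSphereDynamicsProofs`). Mathlib's `measurable_uncurry_of_continuous_of_measurable` needs
continuity in the parameter, which hard-sphere orbits lack (velocities jump), hence the direct
dyadic argument.

## References

* C. Cercignani, R. Illner, M. Pulvirenti, *The Mathematical Theory of Dilute Gases* (1994),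
  §4.2, App. 4.A.
* I. Gallagher, L. Saint-Raymond, B. Texier, *From Newton to Boltzmann* (2013), §4.2.
-/

open Set Filter Topology Function MeasureTheory
open scoped ENNReal

namespace Literature.Analysis.FluidPDE

noncomputable section

section Kinetic

variable {d : Type*} [Fintype d] {X : Type*} {N : ℕ}
variable [MeasureSpace X] [TopologicalSpace X] {G : Geometry d X} {ε : ℝ}

namespace HardSphereFlow

/-! ## The dyadic approximation from the right -/

/-- The dyadic grid points `d_n(s) = (⌊2ⁿ s⌋ + 1) / 2ⁿ` lie strictly to the right of `s`, within
`2⁻ⁿ` of it, and hence converge to `s` from the right. [folklore] -/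
theorem tendsto_dyadicUpper (s : ℝ) :
    Tendsto (fun n : ℕ => ((⌊s * 2 ^ n⌋ + 1 : ℤ) : ℝ) / 2 ^ n) atTop (𝓝[>] s) := by
  have hlt : ∀ n : ℕ, s < ((⌊s * 2 ^ n⌋ + 1 : ℤ) : ℝ) / 2 ^ n := fun n => by
    rw [lt_div_iff₀ (by positivity)]
    exact_mod_cast Int.lt_floor_add_one (s * 2 ^ n)
  have hle : ∀ n : ℕ, ((⌊s * 2 ^ n⌋ + 1 : ℤ) : ℝ) / 2 ^ n ≤ s + 1 / 2 ^ n := fun n => by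
    rw [div_le_iff₀ (by positivity), add_mul, one_div_mul_cancel (by positivity : (2 : ℝ) ^ n ≠ 0)]
    push_cast
    linarith [Int.floor_le (s * 2 ^ n)]
  refine tendsto_nhdsWithin_iff.2 ⟨?_, Eventually.of_forall hlt⟩
  have h1 : Tendsto (fun n : ℕ => s + 1 / (2 : ℝ) ^ n) atTop (𝓝 s) := by
    have h0 : Tendsto (fun n : ℕ => 1 / (2 : ℝ) ^ n) atTop (𝓝 0) := by
      simpa only [one_div, inv_pow] using
        tendsto_pow_atTop_nhds_zero_of_lt_one (by norm_num : (0 : ℝ) ≤ 2⁻¹)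
          (by norm_num : (2 : ℝ)⁻¹ < 1)
    simpa using tendsto_const_nhds.add h0
  exact tendsto_of_tendsto_of_tendsto_of_le_of_le tendsto_const_nhds h1 (fun n => (hlt n).le) hle

/-- The index `⌊2ⁿ s⌋` of the dyadic cell of `s` is a measurable function of `s`. [folklore] -/
theorem measurable_dyadicIndex (n : ℕ) : Measurable fun s : ℝ => ⌊s * 2 ^ n⌋ :=
  Int.measurable_floor.comp (measurable_id.mul_const _)

/-! ## Joint measurability of the flow on the good set -/

/-- **Joint measurability of the hard-sphere flow on its good set.** For a hard-sphere flow on a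
metrizable, second-countable, Borel position space with continuous translations (e.g. `ℝ^d`,
`T^d`), the map `(z, s) ↦ Φ_s z` is measurable on `Φ.good × ℝ`. Proof: `Φ_s z` is the limit of
`Φ_{d_n(s)} z` with `d_n(s) ↓ s` the dyadic grid points to the right of `s` (orbits of good points
are right-continuous, `IsHardSphereTrajectory.tendsto_nhdsGT`), and each approximant factors
through the countable-valued measurable index `⌊2ⁿ s⌋`, hence is measurable
(`measurable_from_prod_countable_left`); limits of measurable maps into a metrizable space are
measurable. (Outside the good set `Φ` is junk and nothing is claimed.) [folklore] -/
theorem measurable_flow_prod [TopologicalSpace.PseudoMetrizableSpace X]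
    [SecondCountableTopology X] [BorelSpace X] (Φ : HardSphereFlow G ε N)
    (hG : ∀ x : X, Continuous (G.translate x)) :
    Measurable fun p : Φ.good × ℝ => Φ.flow p.2 (p.1 : Config N d X) := by
  let u : ℕ → Φ.good × ℝ → Config N d X := fun n p =>
    Φ.flow (((⌊p.2 * 2 ^ n⌋ + 1 : ℤ) : ℝ) / 2 ^ n) p.1
  have hu : ∀ n, Measurable (u n) := by
    intro n
    have hg : Measurable fun q : Φ.good × ℤ =>
        Φ.flow (((q.2 + 1 : ℤ) : ℝ) / 2 ^ n) (q.1 : Config N d X) :=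
      measurable_from_prod_countable_left fun k => by
        show Measurable fun x : Φ.good => Φ.flow (((k + 1 : ℤ) : ℝ) / 2 ^ n) (x : Config N d X)
        exact (Φ.measurable_flow _).comp measurable_subtype_coe
    exact hg.comp (measurable_fst.prodMk ((measurable_dyadicIndex n).comp measurable_snd))
  refine measurable_of_tendsto_metrizable hu ?_
  rw [tendsto_pi_nhds]
  rintro ⟨z, s⟩
  exact ((Φ.isTrajectory z z.2).tendsto_nhdsGT hG s).comp (tendsto_dyadicUpper s)

/-- With the arguments in the order `(s, z)`: `(s, z) ↦ Φ_s z` is measurable on `ℝ × Φ.good`. [folklore] -/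
theorem measurable_flow_prod' [TopologicalSpace.PseudoMetrizableSpace X]
    [SecondCountableTopology X] [BorelSpace X] (Φ : HardSphereFlow G ε N)
    (hG : ∀ x : X, Continuous (G.translate x)) :
    Measurable fun p : ℝ × Φ.good => Φ.flow p.1 (p.2 : Config N d X) :=
  (Φ.measurable_flow_prod hG).comp measurable_swap

/-! ## Measurability of time integrals along the flow -/

/-- A function on phase space whose restriction to the good set is measurable is a.e.-measurable
for every measure carried by the good set (the good set is measurable; extend by a constant). [folklore] -/
theorem aemeasurable_of_measurable_comp_subtype {β : Type*} [MeasurableSpace β]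
    (Φ : HardSphereFlow G ε N) {g : Config N d X → β} (hg : Measurable fun z : Φ.good => g z)
    {μ : Measure (Config N d X)} (hμ : μ Φ.goodᶜ = 0) : AEMeasurable g μ := by
  classical
  have hae : ∀ᵐ z ∂μ, z ∈ Φ.good := by
    have := compl_mem_ae_iff.2 hμ
    rwa [compl_compl] at this
  cases isEmpty_or_nonempty β with
  | inl hβ =>
    haveI : IsEmpty (Config N d X) := Function.isEmpty g
    exact (Subsingleton.measurable (f := g)).aemeasurable
  | inr hβ =>
    obtain ⟨c⟩ := hβ
    refine ⟨fun z => if hz : z ∈ Φ.good then g z else c,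
      Measurable.dite hg measurable_const Φ.measurableSet_good, ?_⟩
    filter_upwards [hae] with z hz
    simp [hz]

/-- **Time integrals of observables along the flow are measurable on the good set**: for a
strongly measurable observable `f : Config → E` and an s-finite measure `ν` on `ℝ` (e.g. Lebesgue
measure restricted to a window), `z ↦ ∫ f(Φ_s z) dν(s)` is strongly measurable on `Φ.good`
(Fubini measurability, `StronglyMeasurable.integral_prod_right'`, after `measurable_flow_prod`). [folklore] -/
theorem stronglyMeasurable_integral_comp_flow [TopologicalSpace.PseudoMetrizableSpace X]
    [SecondCountableTopology X] [BorelSpace X] {E : Type*} [NormedAddCommGroup E]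
    [NormedSpace ℝ E] (Φ : HardSphereFlow G ε N) (hG : ∀ x : X, Continuous (G.translate x))
    {f : Config N d X → E} (hf : StronglyMeasurable f) (ν : Measure ℝ) [SFinite ν] :
    StronglyMeasurable fun z : Φ.good => ∫ s, f (Φ.flow s (z : Config N d X)) ∂ν :=
  (hf.comp_measurable (Φ.measurable_flow_prod hG)).integral_prod_right'

/-- **Window integrals of real observables along the flow are a.e.-measurable**: for measurable
`f : Config → ℝ`, every window `a..b` and every measure `μ` on phase space carried by the good
set (`μ Φ.goodᶜ = 0`: the Liouville measure, `HardSphereFlow.measure_compl_good`, and all laws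
absolutely continuous with respect to it), `z ↦ ∫_a^b f(Φ_s z) ds` is `μ`-a.e. measurable. [folklore] -/
theorem aemeasurable_intervalIntegral_comp_flow [TopologicalSpace.PseudoMetrizableSpace X]
    [SecondCountableTopology X] [BorelSpace X] (Φ : HardSphereFlow G ε N)
    (hG : ∀ x : X, Continuous (G.translate x)) {f : Config N d X → ℝ} (hf : Measurable f)
    (a b : ℝ) {μ : Measure (Config N d X)} (hμ : μ Φ.goodᶜ = 0) :
    AEMeasurable (fun z => ∫ s in a..b, f (Φ.flow s z)) μ := by
  refine Φ.aemeasurable_of_measurable_comp_subtype ?_ hμ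
  have h1 := (Φ.stronglyMeasurable_integral_comp_flow hG hf.stronglyMeasurable
    (volume.restrict (Ioc a b))).measurable
  have h2 := (Φ.stronglyMeasurable_integral_comp_flow hG hf.stronglyMeasurable
    (volume.restrict (Ioc b a))).measurable
  simp only [intervalIntegral]
  exact h1.sub h2

/-- The Liouville measure is carried by the good set, so window integrals of real measurable
observables along the flow are Liouville-a.e. measurable. [folklore] -/
theorem aemeasurable_intervalIntegral_comp_flow_liouville [TopologicalSpace.PseudoMetrizableSpace X]
    [SecondCountableTopology X] [BorelSpace X] (Φ : HardSphereFlow G ε N)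
    (hG : ∀ x : X, Continuous (G.translate x)) {f : Config N d X → ℝ} (hf : Measurable f)
    (a b : ℝ) :
    AEMeasurable (fun z => ∫ s in a..b, f (Φ.flow s z)) (liouville G N ε) :=
  Φ.aemeasurable_intervalIntegral_comp_flow hG hf a b Φ.measure_compl_good

end HardSphereFlow

end Kinetic

/-! ## The flat torus -/

section TorusGeometry

variable {d : Type*} [Fintype d] {N : ℕ} {ε : ℝ}

/-- On `T^d` the hard-sphere flow is jointly measurable on `Φ.good × ℝ` (all side conditions of
`HardSphereFlow.measurable_flow_prod` hold for the flat torus). [folklore] -/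
theorem HardSphereFlow.measurable_flow_prod_torus (Φ : HardSphereFlow (Torus.geometry d) ε N) :
    Measurable fun p : Φ.good × ℝ => Φ.flow p.2 (p.1 : Config N d (UnitAddTorus d)) :=
  Φ.measurable_flow_prod fun x =>
    (continuous_const.add FunctionSpaces.Torus.continuous_proj :
      Continuous fun v : EuclideanSpace ℝ d => x + FunctionSpaces.Torus.proj v)

/-- On `T^d`, window integrals of real measurable observables along a hard-sphere flow are
a.e.-measurable for every law carried by the good set. [folklore] -/
theorem HardSphereFlow.aemeasurable_intervalIntegral_comp_flow_torus
    (Φ : HardSphereFlow (Torus.geometry d) ε N) {f : Config N d (UnitAddTorus d) → ℝ}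
    (hf : Measurable f) (a b : ℝ) {μ : Measure (Config N d (UnitAddTorus d))}
    (hμ : μ Φ.goodᶜ = 0) : AEMeasurable (fun z => ∫ s in a..b, f (Φ.flow s z)) μ :=
  Φ.aemeasurable_intervalIntegral_comp_flow (fun x =>
    (continuous_const.add FunctionSpaces.Torus.continuous_proj :
      Continuous fun v : EuclideanSpace ℝ d => x + FunctionSpaces.Torus.proj v)) hf a b hμ

end TorusGeometry

end

end Literature.Analysis.FluidPDE
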